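import Literature.NumberTheory.LFunctions.HalaszIntegration
import HarnessLib

/-!
# Granville–Soundararajan 2003, (3.7) with the sharp constant

Fourth file of the proof of Theorem 1 of Granville–Soundararajan (sharp Halász).  The tree's
`Halasz.integral_normSExp_le` is the one-sided form of (3.7) with the crude factor `17` and the
cut-off `α₀ = 1/(2 log x)`; Theorem 1 needs the factor `2` exactly:
`1/u = 2∫_0^∞ e^{-2αu} dα`, and restricting `α` to `[α₀, 1]` with `α₀ = 1/log² x` loses only
`(1 - e^{-2α₀u})/u + e^{-2u}/u ≤ 2α₀ + e^{-2u}/u`, which after the weight `|A(e^u)| e^{-u} ≤ u`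
integrates over `u ∈ [log 2, log x]` to `O(1)`.  Hence, with `S(y) = ∑_{n ≤ y} g(n)`,
`A(y) = ∑_{n ≤ y} g̃(n) log n` (`g̃` the `(⌊x⌋+1)`-smooth truncation) and any `1`-bounded `g`,
`∫_{log 2}^{log x} |S(e^u)| e^{-u} du
   ≤ 2 ∫_{α₀}^{1} ∫_{log 2}^{log x} |A(e^u)| e^{-(1+2α)u} du dα + log log x + 3`.

## Main results
- `inv_le_two_mul_integral_add` : `1/u ≤ 2∫_{α₀}^1 e^{-2αu} dα + 2α₀ + e^{-2u}/u` (`u > 0`).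
- `integral_normSExp_le_sharp` : the displayed estimate (GS03 (3.7), sharp, one-sided).

## References
- [GranvilleSoundararajan2003] A. Granville, K. Soundararajan, *Decay of mean values of
  multiplicative functions*, Canad. J. Math. 55 (2003), §3b, (3.7), arXiv math/9911246 p. 7.

## Design choices
* Same coordinates and kernel as `HalaszIntegration.lean` (`u = log y`, Fubini on the rectangle
  `(α₀, 1] × (log 2, log x]`); only the pointwise representation of `1/u` changes.
-/

noncomputable section

open Finset Real Complex MeasureTheory Set Filter

namespace Literature.NumberTheory.LFunctions

namespace GranvilleSoundararajan

open MellinPlancherel (psum)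
open Halasz (mulLog normSExp normSExp_le integral_exp_neg_two_mul norm_psum_mulLog_le_mul_log
  intervalIntegrable_normSExp)

variable {g : ℕ → ℂ}

/-- **The `α`-representation of `1/u`, sharp**: for `u > 0` and any `α₀`,
`1/u ≤ 2 ∫_{α₀}^{1} e^{-2αu} dα + (2α₀ + e^{-2u}/u)` (equality for `α ∈ (0, ∞)`; the two
correction terms are the pieces `α < α₀`, bounded using `1 - e^{-2α₀u} ≤ 2α₀u`, and `α > 1`).
[cite: GranvilleSoundararajan2003, (3.7)] -/
theorem inv_le_two_mul_integral_add {u : ℝ} (hu : 0 < u) (α₀ : ℝ) :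
    1 / u ≤ 2 * (∫ α in α₀..1, Real.exp (-(2 * α * u))) + (2 * α₀ + Real.exp (-(2 * u)) / u) := by
  rw [integral_exp_neg_two_mul _ hu.ne']
  have hexp := Real.add_one_le_exp (-(2 * α₀ * u))
  have key : 1 ≤ Real.exp (-(2 * α₀ * u)) + 2 * α₀ * u := by linarith
  have hrw : 2 * ((Real.exp (-(2 * α₀ * u)) - Real.exp (-(2 * u))) / (2 * u)) +
      (2 * α₀ + Real.exp (-(2 * u)) / u) = (Real.exp (-(2 * α₀ * u)) + 2 * α₀ * u) / u := by
    field_simp; ring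
  rw [hrw, div_le_div_iff_of_pos_right hu]
  exact key

/-- `∫_{log 2}^{log x} (1/u + 2α₀u + e^{-2u}) du ≤ log log x + 3` for `α₀ = 1/log² x`, `x ≥ 3`.
[folklore] -/
theorem integral_remainder_le {x : ℝ} (hx : 3 ≤ x) :
    ∫ u in Real.log 2..Real.log x, (1 / u + 2 * (1 / Real.log x ^ 2) * u + Real.exp (-(2 * u))) ≤
      Real.log (Real.log x) + 3 := by
  have hlog2 : (0.6931471803 : ℝ) < Real.log 2 := Real.log_two_gt_d9
  have hlog2' : Real.log 2 < 0.6931471808 := Real.log_two_lt_d9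
  have hlx : Real.log 2 ≤ Real.log x := Real.log_le_log (by norm_num) (by linarith)
  have hlx1 : 1 < Real.log x := by
    rw [← Real.log_exp 1]
    refine Real.log_lt_log (Real.exp_pos 1) ?_
    have := Real.exp_one_lt_d9
    linarith
  have hl0 : 0 < Real.log x := by linarith
  have hi1 : IntervalIntegrable (fun u : ℝ => 1 / u) volume (Real.log 2) (Real.log x) := by
    refine (continuousOn_const.div continuousOn_id fun u hu => ?_).intervalIntegrable
    rw [Set.uIcc_of_le hlx] at hu
    exact (ne_of_gt (by linarith [hu.1] : (0:ℝ) < u))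
  have hi2 : IntervalIntegrable (fun u : ℝ => 2 * (1 / Real.log x ^ 2) * u) volume (Real.log 2) (Real.log x) :=
    (continuous_const.mul continuous_id).intervalIntegrable _ _
  have hi3 : IntervalIntegrable (fun u : ℝ => Real.exp (-(2 * u))) volume (Real.log 2) (Real.log x) :=
    (by fun_prop : Continuous fun u : ℝ => Real.exp (-(2 * u))).intervalIntegrable _ _
  rw [intervalIntegral.integral_add (hi1.add hi2) hi3, intervalIntegral.integral_add hi1 hi2]
  -- `∫ 1/u = log log x - log log 2 ≤ log log x + 1`
  have h1 : ∫ u in Real.log 2..Real.log x, 1 / u ≤ Real.log (Real.log x) + 1 := by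
    rw [integral_one_div_of_pos (by linarith) (by linarith), Real.log_div (by linarith) (by linarith)]
    have : -1 ≤ Real.log (Real.log 2) := by
      rw [← Real.log_exp (-1)]
      refine Real.log_le_log (Real.exp_pos _) ?_
      rw [Real.exp_neg]
      have := Real.exp_one_gt_d9
      rw [inv_le_comm₀ (Real.exp_pos 1) (by linarith)]
      have h2 : (Real.log 2)⁻¹ ≤ 2 := by
        rw [inv_le_comm₀ (by linarith) (by norm_num)]; linarith
      linarith
    linarith
  -- `∫ 2α₀ u = α₀ (log² x - log² 2) ≤ 1`
  have h2 : ∫ u in Real.log 2..Real.log x, 2 * (1 / Real.log x ^ 2) * u ≤ 1 := by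
    rw [intervalIntegral.integral_const_mul, integral_id]
    have hl2sq : 0 ≤ Real.log 2 ^ 2 := sq_nonneg _
    have hlxsq : 0 < Real.log x ^ 2 := by positivity
    calc 2 * (1 / Real.log x ^ 2) * ((Real.log x ^ 2 - Real.log 2 ^ 2) / 2)
        = (Real.log x ^ 2 - Real.log 2 ^ 2) / Real.log x ^ 2 := by field_simp
      _ ≤ Real.log x ^ 2 / Real.log x ^ 2 := by gcongr; linarith
      _ = 1 := div_self hlxsq.ne'
  -- `∫ e^{-2u} ≤ 1/2`
  have h3 : ∫ u in Real.log 2..Real.log x, Real.exp (-(2 * u)) ≤ 1 / 2 := by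
    have hrw : ∀ u : ℝ, -(2 * u) = (-2) * u := fun u => by ring
    simp_rw [hrw]
    rw [intervalIntegral.integral_comp_mul_left (f := Real.exp) (by norm_num : (-2 : ℝ) ≠ 0), integral_exp,
      smul_eq_mul]
    have he1 : Real.exp (-2 * Real.log x) ≥ 0 := (Real.exp_pos _).le
    have he2 : Real.exp (-2 * Real.log 2) ≤ 1 := by
      rw [Real.exp_le_one_iff]; nlinarith
    rw [show ((-2 : ℝ))⁻¹ = -(1 / 2) by norm_num]
    nlinarith
  linarith

/-- **GS03 (3.7), sharp constant, one-sided**: for `x ≥ 3`, `N = ⌊x⌋`, `A = ∑_{n ≤ ·} g̃(n) log n`,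
`α₀ = 1/log² x` and any `1`-bounded `g`,
`∫_{log 2}^{log x} |S(e^u)| e^{-u} du ≤ 2 ∫_{α₀}^{1} (∫_{log 2}^{log x} |A(e^u)| e^{-(1+2α)u} du) dα
  + log log x + 3`. [cite: GranvilleSoundararajan2003, (3.7)] -/
theorem integral_normSExp_le_sharp (hgb : ∀ n, ‖g n‖ ≤ 1) {x : ℝ} (hx : 3 ≤ x) :
    ∫ u in Real.log 2..Real.log x, normSExp g u ≤
      2 * (∫ α in Set.Ioc (1 / Real.log x ^ 2) 1,
              ∫ u in Set.Ioc (Real.log 2) (Real.log x),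
                ‖psum (mulLog g ⌊x⌋₊) (Real.exp u)‖ * Real.exp (-((1 + 2 * α) * u))) +
        (Real.log (Real.log x) + 3) := by
  set N : ℕ := ⌊x⌋₊ with hN
  set α₀ : ℝ := 1 / Real.log x ^ 2 with hα₀
  set S : Set ℝ := Set.Ioc α₀ 1 with hS
  set T : Set ℝ := Set.Ioc (Real.log 2) (Real.log x) with hT
  set K : ℝ → ℝ → ℝ := fun α u =>
    ‖psum (mulLog g N) (Real.exp u)‖ * Real.exp (-((1 + 2 * α) * u)) with hK
  have hlog2 : (0.6931471803 : ℝ) < Real.log 2 := Real.log_two_gt_d9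
  have hx1 : (1 : ℝ) ≤ x := by linarith
  have hlx : Real.log 2 ≤ Real.log x := Real.log_le_log (by norm_num) (by linarith)
  have hlx3 : 1 < Real.log x := by
    rw [← Real.log_exp 1]
    refine Real.log_lt_log (Real.exp_pos 1) ?_
    have := Real.exp_one_lt_d9
    linarith
  have hα₀0 : 0 ≤ α₀ := by rw [hα₀]; positivity
  have hα₀1 : α₀ ≤ 1 := by
    rw [hα₀, div_le_one (by positivity)]; nlinarith
  -- integrability of the kernel in both orders
  have hKint := Halasz.integrable_kernel hgb N hx1 hα₀0
  have hKint' : Integrable (Function.uncurry fun u α => K α u)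
      ((volume.restrict T).prod (volume.restrict S)) := hKint.swap
  have hIu : Integrable (fun u => ∫ α in S, K α u) (volume.restrict T) := by
    have := hKint'.integral_prod_left
    simpa [Function.uncurry] using this
  -- pointwise bound on `[log 2, log x]`
  have hpt : ∀ u ∈ Set.Icc (Real.log 2) (Real.log x),
      normSExp g u ≤ 2 * (∫ α in S, K α u) + (1 / u + 2 * (1 / Real.log x ^ 2) * u + Real.exp (-(2 * u))) := by
    intro u hu
    have hu0 : 0 < u := by linarith [hu.1]
    have huN : ⌊Real.exp u⌋₊ ≤ N := by
      rw [hN]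
      refine Nat.floor_le_floor ?_
      calc Real.exp u ≤ Real.exp (Real.log x) := Real.exp_le_exp.2 hu.2
        _ = x := Real.exp_log (by linarith)
    refine (normSExp_le hgb hu0 huN).trans ?_
    have hrep := inv_le_two_mul_integral_add hu0 α₀
    set a : ℝ := ‖psum (mulLog g N) (Real.exp u)‖ * Real.exp (-u) with ha
    have hA0 : 0 ≤ a := by positivity
    -- `a ≤ u`
    have hau : a ≤ u := by
      have h1 : (1 : ℝ) ≤ Real.exp u := by simpa using Real.one_le_exp hu0.le
      have hb := norm_psum_mulLog_le_mul_log hgb N h1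
      rw [Real.log_exp] at hb
      calc a ≤ Real.exp u * u * Real.exp (-u) := by rw [ha]; gcongr
        _ = u := by rw [mul_comm (Real.exp u), mul_assoc, ← Real.exp_add]; simp
    have hcorr0 : 0 ≤ 2 * α₀ + Real.exp (-(2 * u)) / u := by positivity
    -- the integral term
    have hI : a * (2 * ∫ α in α₀..1, Real.exp (-(2 * α * u))) = 2 * ∫ α in S, K α u := by
      rw [← intervalIntegral.integral_const_mul, ← intervalIntegral.integral_const_mul,
        intervalIntegral.integral_of_le hα₀1, ← integral_const_mul]
      refine setIntegral_congr_fun measurableSet_Ioc fun α _ => ?_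
      simp only [hK, ha]
      have hexp : Real.exp (-u) * Real.exp (-(2 * α * u)) = Real.exp (-((1 + 2 * α) * u)) := by
        rw [← Real.exp_add]; congr 1; ring
      rw [← hexp]; ring
    calc a / u + 1 / u = a * (1 / u) + 1 / u := by ring
      _ ≤ a * (2 * (∫ α in α₀..1, Real.exp (-(2 * α * u))) + (2 * α₀ + Real.exp (-(2 * u)) / u)) + 1 / u := by
          gcongr
      _ = 2 * (∫ α in S, K α u) + a * (2 * α₀ + Real.exp (-(2 * u)) / u) + 1 / u := by
          rw [mul_add, hI]
      _ ≤ 2 * (∫ α in S, K α u) + u * (2 * α₀ + Real.exp (-(2 * u)) / u) + 1 / u := by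
          gcongr
      _ = 2 * (∫ α in S, K α u) + (1 / u + 2 * (1 / Real.log x ^ 2) * u + Real.exp (-(2 * u))) := by
          rw [hα₀]; field_simp; ring
  -- integrate the pointwise bound
  have hnormInt := intervalIntegrable_normSExp hgb (Real.log 2) (Real.log x)
  have hRcont : ContinuousOn (fun u : ℝ => 1 / u + 2 * (1 / Real.log x ^ 2) * u + Real.exp (-(2 * u)))
      (Set.uIcc (Real.log 2) (Real.log x)) := by
    refine ((continuousOn_const.div continuousOn_id fun u hu => ?_).add (by fun_prop)).add (by fun_prop)
    rw [Set.uIcc_of_le hlx] at hu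
    exact (ne_of_gt (by linarith [hu.1] : (0:ℝ) < u))
  have hRint : IntervalIntegrable (fun u : ℝ => 1 / u + 2 * (1 / Real.log x ^ 2) * u + Real.exp (-(2 * u)))
      volume (Real.log 2) (Real.log x) := hRcont.intervalIntegrable
  have hKuInt : IntervalIntegrable (fun u => 2 * ∫ α in S, K α u) volume (Real.log 2) (Real.log x) := by
    rw [intervalIntegrable_iff_integrableOn_Ioc_of_le hlx]
    exact hIu.const_mul 2
  calc ∫ u in Real.log 2..Real.log x, normSExp g u
      ≤ ∫ u in Real.log 2..Real.log x,
          (2 * (∫ α in S, K α u) + (1 / u + 2 * (1 / Real.log x ^ 2) * u + Real.exp (-(2 * u)))) :=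
        intervalIntegral.integral_mono_on hlx hnormInt (hKuInt.add hRint) hpt
    _ = 2 * (∫ u in Real.log 2..Real.log x, ∫ α in S, K α u) +
          ∫ u in Real.log 2..Real.log x, (1 / u + 2 * (1 / Real.log x ^ 2) * u + Real.exp (-(2 * u))) := by
        rw [intervalIntegral.integral_add hKuInt hRint, intervalIntegral.integral_const_mul]
    _ ≤ 2 * (∫ α in S, ∫ u in T, K α u) + (Real.log (Real.log x) + 3) := by
        gcongr ?_ + ?_
        · refine le_of_eq ?_
          congr 1
          rw [intervalIntegral.integral_of_le hlx]
          exact integral_integral_swap hKint'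
        · exact integral_remainder_le hx

end GranvilleSoundararajan

end Literature.NumberTheory.LFunctions
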